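import Literature.Topology.FourManifolds.BandSumCommProofs
import HarnessLib

/-!
# The summands of a band sum are disjoint: discharge of `Knot.IsBandSum.disjoint_range`

Sibling proof file of `Literature.Topology.FourManifolds.BandSum` (D-0014: the named fact
`def X : Prop` is discharged by `theorem X_holds : X`). It proves

* `Literature.Topology.FourManifolds.Knot.IsBandSum.disjoint_range_holds` — discharge of
  `Literature.Topology.FourManifolds.Knot.IsBandSum.disjoint_range` (`BandSum.lean`): if `K` is a
  band sum of `K₁`, `K₂` in the sense of `BandData` (for *any* band data: no regularity of the
  band at the attaching corners is used), then `range K₁` and `range K₂` are disjoint;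
* `Literature.Topology.FourManifolds.BandData.disjoint_range` (the same for given band data) and
  the unconditional forms `BandData.orient_upper'`, `BandData.exists_halfTurn'` of the coherence
  statements of `BandSumCommProofs.lean`.

*Proof* (a circular-order argument on the parameter line, `KnotArcLift.lean`). Write
`S = band '' squareNhd δ` for the band surface. Inside `S` the summands are disjoint
(`BandData.disjoint_inter_support`: they are the two edge lines). Outside: `K₁ ∩ S` is the open
left edge, an open arc of `K₁`, so `C₁ = K₁ ∖ S` is the image of the complementary closed
parameter window and is **connected** (`Knot.isConnected_range_diff_image_Ioo`); likewise
`C₂ = K₂ ∖ S`. On the other hand `K ∖ S = C₁ ∪ C₂` (`range_diff`), and `K ∩ S` is the union of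
the two disjoint open arcs `band ∘ lowerArc`, `band ∘ upperArc` of `K` (`preimage_range`), whose
parameter windows `(a, b)` and `(c, d) ⊆ [b, a + 1]` on the parameter line (period `1`) leave two
nonempty, disjoint, closed gaps `[b, c]` and `[d, a + 1]`; so `K ∖ S = P ⊔ Q` with `P`, `Q` the
(nonempty, disjoint, compact) images of the gaps (`Knot.exists_isClosed_union_eq_range_diff`).
A connected `Cᵢ` lies in `P` or in `Q`; if `C₁` and `C₂` met they would lie in the same piece and
the other piece, being contained in `C₁ ∪ C₂`, would be empty. Hence `C₁ ∩ C₂ = ∅`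
(`disjoint_of_isPreconnected_of_union_eq`), and with the disjointness inside `S` the summands are
disjoint.

## References

* R. E. Gompf, A. I. Stipsicz, *4-Manifolds and Kirby Calculus*, GSM 20, AMS (1999), §5.1
  (band sums; the locator carried by the named fact). [GompfStipsicz1999]
* P. R. Cromwell, *Knots and Links*, Cambridge University Press (2004), §4.6 (the product
  `(L₁ - a) ∪ (L₂ - c) ∪ b ∪ d` of a split link along a rectangle). [Cromwell2004]
* A. Hatcher, *Algebraic Topology* (2002), Prop. 1.30 (path lifting), as used through
  `KnotArcLift.lean`.

## Design notes

* Only `BandSumCommProofs.lean` (lifts and windows of the two arcs) is imported; the two edge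
  lines are parametrised here uniformly as `s ↦ band (a, -δ + s (1 + 2δ))`, `a = 0, 1` (the left
  one is `BandData.leftEdge` of `BandSumJunction.lean`, which is not imported to keep this
  discharge light).
* The file declares theorems only (no `def`, no notation): everything here is proved, no named
  facts are introduced, no statement of another file is modified; `sphere (0 : EuclideanSpace ℝ
  (Fin 4)) 1` is the `𝕊 3` of `Knots.lean`, as in `BandSumCommProofs.lean`.
-/

open scoped Manifold ContDiff Topology Real
open Function Set Metric

noncomputable section

namespace Literature.Topology.FourManifolds

/-! ## A point-set lemma -/

/-- **Two preconnected sets filling two separated pieces are disjoint.** If `C₁ ∪ C₂ = P ∪ Q`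
with `P`, `Q` closed, disjoint and both nonempty, and `C₁`, `C₂` are preconnected, then `C₁` and
`C₂` are disjoint: each `Cᵢ` lies in `P` or in `Q`; if they met they would lie in the same piece,
and the other piece (contained in `C₁ ∪ C₂`) would be empty. [folklore] -/
theorem disjoint_of_isPreconnected_of_union_eq {X : Type*} [TopologicalSpace X]
    {C₁ C₂ P Q : Set X} (h₁ : IsPreconnected C₁) (h₂ : IsPreconnected C₂) (hP : IsClosed P)
    (hQ : IsClosed Q) (hPQ : Disjoint P Q) (hPne : P.Nonempty) (hQne : Q.Nonempty)
    (hU : C₁ ∪ C₂ = P ∪ Q) : Disjoint C₁ C₂ := by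
  have hside : ∀ {C : Set X}, IsPreconnected C → C ⊆ P ∪ Q → C ⊆ P ∨ C ⊆ Q :=
    fun hC hCs ↦ (isPreconnected_iff_subset_of_disjoint_closed.1 hC) P Q hP hQ hCs
      (by rw [hPQ.inter_eq, inter_empty])
  have hC₁ : C₁ ⊆ P ∪ Q := hU ▸ subset_union_left
  have hC₂ : C₂ ⊆ P ∪ Q := hU ▸ subset_union_right
  have hPsub : P ⊆ C₁ ∪ C₂ := hU ▸ subset_union_left
  have hQsub : Q ⊆ C₁ ∪ C₂ := hU ▸ subset_union_right
  rcases hside h₁ hC₁ with h1 | h1 <;> rcases hside h₂ hC₂ with h2 | h2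
  · exfalso
    obtain ⟨q, hq⟩ := hQne
    have hq' : q ∈ P := by
      rcases hQsub hq with h | h
      · exact h1 h
      · exact h2 h
    exact Set.disjoint_left.1 hPQ hq' hq
  · exact Set.disjoint_of_subset h1 h2 hPQ
  · exact Set.disjoint_of_subset h1 h2 hPQ.symm
  · exfalso
    obtain ⟨p, hp⟩ := hPne
    have hp' : p ∈ Q := by
      rcases hPsub hp with h | h
      · exact h1 h
      · exact h2 h
    exact Set.disjoint_left.1 hPQ hp hp'

/-! ## Windows on the parameter line of a knot -/

namespace Knot

variable (K : Knot)

/-- **The complement of an open arc of a knot is the image of the complementary closed window.**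
If `φ` (continuous on `[0, 1]`, strictly increasing on `(0, 1)`) lifts the arc `γ` through
`K ∘ circlePt`, then `range K ∖ γ '' (0, 1)` is the image under `K ∘ circlePt` of the closed
window `[φ 1, φ 0 + 1]` (nonempty when `γ` is injective on `(0, 1)`, `Knot.lift_one_le`): a parameter normalised
into `[φ 1, φ 1 + 1)` maps to the open arc iff it exceeds `φ 0 + 1` (window lemmas
`Knot.exists_sub_int_mem_Ioo_of_lift`, `Knot.apply_circlePt_mem_image_of_lift`). [folklore] -/
theorem range_diff_image_Ioo_eq_of_lift {γ : ℝ → sphere (0 : EuclideanSpace ℝ (Fin 4)) 1} {φ : ℝ → ℝ}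
    (hφ : ContinuousOn φ (Icc 0 1)) (hmono : StrictMonoOn φ (Ioo 0 1))
    (heq : ∀ s ∈ Icc (0 : ℝ) 1, K (circlePt (φ s)) = γ s) :
    range K \ γ '' Ioo 0 1 = (fun t ↦ K (circlePt t)) '' Icc (φ 1) (φ 0 + 1) := by
  have hgper : ∀ (t : ℝ) (m : ℤ), K (circlePt (t + m)) = K (circlePt t) := fun t m ↦ by
    rw [circlePt_add_int]
  ext x
  constructor
  · rintro ⟨⟨y, rfl⟩, hx⟩
    obtain ⟨t₀, rfl⟩ : ∃ t₀, circlePt t₀ = y := ⟨angA y, circlePt_angA y⟩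
    -- normalise the parameter into `[φ 1, φ 1 + 1)`
    set m : ℤ := ⌊t₀ - φ 1⌋ with hm
    set t : ℝ := t₀ - m with ht
    have ht1 : φ 1 ≤ t := by have := Int.floor_le (t₀ - φ 1); rw [ht]; linarith
    have ht2 : t < φ 1 + 1 := by have := Int.lt_floor_add_one (t₀ - φ 1); rw [ht]; linarith
    have hKt : K (circlePt t) = K (circlePt t₀) := by
      rw [ht, sub_eq_add_neg, ← Int.cast_neg, hgper]
    refine ⟨t, ⟨ht1, ?_⟩, hKt⟩
    by_contra! hlt
    apply hx
    have hmem : t - 1 ∈ Ioo (φ 0) (φ 1) := ⟨by linarith, by linarith⟩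
    have h := K.apply_circlePt_mem_image_of_lift hφ hmono heq hmem
    rwa [show t - 1 = t + ((-1 : ℤ) : ℝ) by push_cast; ring, hgper, hKt] at h
  · rintro ⟨t, ht, rfl⟩
    refine ⟨mem_range_self _, fun hx ↦ ?_⟩
    obtain ⟨m, hm1, hm2⟩ := K.exists_sub_int_mem_Ioo_of_lift hφ hmono heq hx
    rcases le_or_gt m 0 with hm0 | hm0
    · have : (m : ℝ) ≤ 0 := by exact_mod_cast hm0
      linarith [ht.1]
    · have : (1 : ℝ) ≤ m := by exact_mod_cast hm0
      linarith [ht.2]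

/-- **The complement of an open embedded arc of a knot is connected.** If `γ : ℝ → 𝕊³` is
continuous with `γ '' [0, 1] ⊆ range K` and injective on `(0, 1)`, then `range K ∖ γ '' (0, 1)`
is connected: a lift of `γ` (`Knot.exists_lift`) is strictly monotone
(`Knot.strictMonoOn_or_strictAntiOn_lift`; reverse the arc if it is decreasing), and the
complement is the continuous image of a nonempty closed interval
(`range_diff_image_Ioo_eq_of_lift`). [folklore] -/
theorem isConnected_range_diff_image_Ioo {γ : ℝ → sphere (0 : EuclideanSpace ℝ (Fin 4)) 1} (hγ : Continuous γ)
    (hmem : ∀ s ∈ Icc (0 : ℝ) 1, γ s ∈ range K) (hinj : InjOn γ (Ioo 0 1)) :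
    IsConnected (range K \ γ '' Ioo 0 1) := by
  have hKc : Continuous fun t : ℝ ↦ K (circlePt t) := K.continuous.comp continuous_circlePt
  have key : ∀ {γ' : ℝ → sphere (0 : EuclideanSpace ℝ (Fin 4)) 1} {φ : ℝ → ℝ}, ContinuousOn φ (Icc 0 1) →
      StrictMonoOn φ (Ioo 0 1) → (∀ s ∈ Icc (0 : ℝ) 1, K (circlePt (φ s)) = γ' s) →
      InjOn γ' (Ioo 0 1) → IsConnected (range K \ γ' '' Ioo 0 1) := by
    intro γ' φ hφ hmono heq hinj'
    rw [K.range_diff_image_Ioo_eq_of_lift hφ hmono heq]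
    exact (isConnected_Icc (K.lift_one_le hφ hmono heq hinj')).image _ hKc.continuousOn
  obtain ⟨φ, hφ, heq⟩ := K.exists_lift hγ hmem
  rcases K.strictMonoOn_or_strictAntiOn_lift zero_lt_one hφ.continuousOn
    (fun s hs ↦ heq s (Ioo_subset_Icc_self hs)) hinj with hmono | hanti
  · exact key hφ.continuousOn hmono heq hinj
  · -- reverse the arc: `s ↦ γ (1 - s)` has the increasing lift `s ↦ φ (1 - s)`
    have himage : (fun s : ℝ ↦ γ (1 - s)) '' Ioo 0 1 = γ '' Ioo 0 1 := by
      rw [← Set.image_image γ (fun s : ℝ ↦ 1 - s), Set.image_const_sub_Ioo]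
      norm_num
    have hmaps : MapsTo (fun s : ℝ ↦ 1 - s) (Icc 0 1) (Icc 0 1) := fun s hs ↦
      ⟨by linarith [hs.2], by linarith [hs.1]⟩
    rw [← himage]
    refine key (φ := fun s ↦ φ (1 - s))
      (hφ.comp (continuous_const.sub continuous_id)).continuousOn
      (fun x hx y hy hxy ↦ hanti ⟨by linarith [hy.2], by linarith [hy.1]⟩
        ⟨by linarith [hx.2], by linarith [hx.1]⟩ (by linarith))
      (fun s hs ↦ heq (1 - s) (hmaps hs)) ?_
    intro x hx y hy hxy
    have h := hinj ⟨by linarith [hx.2], by linarith [hx.1]⟩ ⟨by linarith [hy.2], by linarith [hy.1]⟩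
      hxy
    linarith

/-- **Two disjoint open arcs of a knot leave two closed gaps.** Let `ℓ`, `u : ℝ → 𝕊³` be arcs on
`K` over `[0, 1]`, injective on `(0, 1)` with disjoint open images, lifted through `K ∘ circlePt`
by `φ`, `ψ` (continuous on `[0, 1]`, strictly increasing on `(0, 1)`). Then
`range K ∖ (ℓ '' (0, 1) ∪ u '' (0, 1)) = P ∪ Q` for two closed, disjoint, **nonempty** sets
`P`, `Q`: with `a = φ 0 < b = φ 1 ≤ a + 1` and the window of `u` translated by an integer to
`(c, d) ⊆ [b, a + 1]` (it misses the open parameter set of `ℓ`), take the images of the gaps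
`[b, c]` and `[d, a + 1]`. Same normalisation as in `Knot.apply_zero_mem_of_lifts`
(`BandSumCommProofs.lean`). [folklore] -/
theorem exists_isClosed_union_eq_range_diff {ℓ u : ℝ → sphere (0 : EuclideanSpace ℝ (Fin 4)) 1} {φ ψ : ℝ → ℝ}
    (hφ : ContinuousOn φ (Icc 0 1)) (hψ : ContinuousOn ψ (Icc 0 1))
    (hφℓ : ∀ s ∈ Icc (0 : ℝ) 1, K (circlePt (φ s)) = ℓ s)
    (hψu : ∀ s ∈ Icc (0 : ℝ) 1, K (circlePt (ψ s)) = u s)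
    (hφm : StrictMonoOn φ (Ioo 0 1)) (hψm : StrictMonoOn ψ (Ioo 0 1))
    (hℓinj : InjOn ℓ (Ioo 0 1)) (hdisj : Disjoint (ℓ '' Ioo 0 1) (u '' Ioo 0 1)) :
    ∃ P Q : Set (sphere (0 : EuclideanSpace ℝ (Fin 4)) 1), IsClosed P ∧ IsClosed Q ∧ Disjoint P Q ∧ P.Nonempty ∧ Q.Nonempty ∧
      P ∪ Q = range K \ (ℓ '' Ioo 0 1 ∪ u '' Ioo 0 1) := by
  -- the parametrisation `t ↦ K (circlePt t)` has period `1`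
  have hgc : Continuous fun t : ℝ ↦ K (circlePt t) := K.continuous.comp continuous_circlePt
  have hgper : ∀ (t : ℝ) (m : ℤ), K (circlePt (t + m)) = K (circlePt t) := fun t m ↦ by
    rw [circlePt_add_int]
  set a := φ 0 with ha
  set bb := φ 1 with hbb
  have hab : a < bb := strictMonoOn_Icc_of_Ioo hφ hφm ⟨le_rfl, zero_le_one⟩ ⟨zero_le_one, le_rfl⟩
    zero_lt_one
  have hba : bb ≤ a + 1 := K.lift_one_le hφ hφm hφℓ hℓinj
  set c₀ := ψ 0 with hc₀
  set d₀ := ψ 1 with hd₀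
  have hcd₀ : c₀ < d₀ := strictMonoOn_Icc_of_Ioo hψ hψm ⟨le_rfl, zero_le_one⟩ ⟨zero_le_one, le_rfl⟩
    zero_lt_one
  -- the parameter sets of the two open arcs
  set TL : Set ℝ := {t | K (circlePt t) ∈ ℓ '' Ioo 0 1} with hTL
  set TU : Set ℝ := {t | K (circlePt t) ∈ u '' Ioo 0 1} with hTU
  have hTLU : Disjoint TL TU := by
    rw [Set.disjoint_left]
    intro t ht ht'
    exact Set.disjoint_left.mp hdisj ht ht'
  have memTL : ∀ t, t ∈ TL ↔ ∃ m : ℤ, t - m ∈ Ioo a bb := fun t ↦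
    ⟨fun ht ↦ K.exists_sub_int_mem_Ioo_of_lift hφ hφm hφℓ ht, fun ⟨m, hm⟩ ↦ by
      have h := K.apply_circlePt_mem_image_of_lift hφ hφm hφℓ hm
      have e : K (circlePt (t - m)) = K (circlePt t) := by
        rw [sub_eq_add_neg, ← Int.cast_neg, hgper]
      show K (circlePt t) ∈ ℓ '' Ioo 0 1
      rwa [e] at h⟩
  have memTU : ∀ t, t ∈ TU ↔ ∃ m : ℤ, t - m ∈ Ioo c₀ d₀ := fun t ↦
    ⟨fun ht ↦ K.exists_sub_int_mem_Ioo_of_lift hψ hψm hψu ht, fun ⟨m, hm⟩ ↦ by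
      have h := K.apply_circlePt_mem_image_of_lift hψ hψm hψu hm
      have e : K (circlePt (t - m)) = K (circlePt t) := by
        rw [sub_eq_add_neg, ← Int.cast_neg, hgper]
      show K (circlePt t) ∈ u '' Ioo 0 1
      rwa [e] at h⟩
  have hTLopen : IsOpen TL := by
    have e : TL = ⋃ m : ℤ, (fun t ↦ t - (m : ℝ)) ⁻¹' Ioo a bb := by
      ext t
      simp only [Set.mem_iUnion, Set.mem_preimage]
      exact memTL t
    rw [e]
    exact isOpen_iUnion fun m ↦ isOpen_Ioo.preimage (by fun_prop)
  -- the closed window `[c₀, d₀]` of `u` misses `TL`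
  have hIcc_TL : ∀ t ∈ Icc c₀ d₀, t ∉ TL := by
    have h1 : Ioo c₀ d₀ ⊆ TLᶜ := fun t ht htL ↦
      Set.disjoint_left.mp hTLU htL ((memTU t).2 ⟨0, by simpa using ht⟩)
    have h2 : Icc c₀ d₀ ⊆ TLᶜ := by
      rw [← closure_Ioo hcd₀.ne]
      exact (hTLopen.isClosed_compl.closure_subset_iff).2 h1
    exact fun t ht ↦ h2 ht
  have hper_TL : ∀ (t : ℝ) (m : ℤ), t + m ∈ TL ↔ t ∈ TL := fun t m ↦ by
    show K (circlePt (t + m)) ∈ ℓ '' Ioo 0 1 ↔ K (circlePt t) ∈ ℓ '' Ioo 0 1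
    rw [hgper]
  -- normalise the window of `u` into the segment `[bb, a + 1]`
  set k : ℤ := ⌈bb - c₀⌉ with hk
  have hk1 : bb ≤ c₀ + k := by have := Int.le_ceil (bb - c₀); linarith
  have hk2 : c₀ + k < bb + 1 := by have := Int.ceil_lt_add_one (bb - c₀); linarith
  set c := c₀ + k with hc
  set d := d₀ + k with hd
  have hcd : c < d := by rw [hc, hd]; linarith
  have hbc : bb ≤ c := hk1
  have hca : c ≤ a + 1 := by
    by_contra! hlt
    have hcTL : c ∈ TL := (memTL c).2 ⟨1, by push_cast; constructor <;> linarith⟩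
    rw [hc, hper_TL] at hcTL
    exact hIcc_TL c₀ ⟨le_rfl, hcd₀.le⟩ hcTL
  have hda : d ≤ a + 1 := by
    by_contra! hlt
    set t := min d ((a + bb) / 2 + 1) with ht
    have ht1 : a + 1 < t := lt_min hlt (by linarith)
    have ht2 : t < bb + 1 := (min_le_right _ _).trans_lt (by linarith)
    have ht3 : c < t := lt_min hcd (by linarith)
    have ht4 : t ≤ d := min_le_left _ _
    have htTL : t ∈ TL := (memTL t).2 ⟨1, by push_cast; constructor <;> linarith⟩
    have htk : t - k ∈ Icc c₀ d₀ := ⟨by rw [hc] at ht3; linarith, by rw [hd] at ht4; linarith⟩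
    refine hIcc_TL _ htk ?_
    rwa [sub_eq_add_neg, ← Int.cast_neg, hper_TL]
  -- the two gaps `[bb, c]` and `[d, a + 1]` miss both parameter sets
  have hgapL : ∀ t ∈ Icc bb c, t ∉ TL ∧ t ∉ TU := by
    intro t ht
    refine ⟨fun htL ↦ ?_, fun htU ↦ ?_⟩
    · obtain ⟨m, hm1, hm2⟩ := (memTL t).1 htL
      have hm0 : (0 : ℝ) < m := by linarith [ht.1]
      have hm1' : (1 : ℝ) ≤ m := by exact_mod_cast (show (1 : ℤ) ≤ m by exact_mod_cast hm0)
      linarith [ht.2]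
    · obtain ⟨m, hm1, hm2⟩ := (memTU t).1 htU
      have hkm0 : (0 : ℝ) < k - m := by rw [hc] at ht; linarith [ht.2]
      have hkm1 : (1 : ℝ) ≤ k - m := by
        exact_mod_cast (show (1 : ℤ) ≤ k - m by exact_mod_cast hkm0)
      rw [hd] at hda
      linarith [ht.1]
  have hgapR : ∀ t ∈ Icc d (a + 1), t ∉ TL ∧ t ∉ TU := by
    intro t ht
    have htc : c < t := hcd.trans_le ht.1
    refine ⟨fun htL ↦ ?_, fun htU ↦ ?_⟩
    · obtain ⟨m, hm1, hm2⟩ := (memTL t).1 htL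
      have hm0 : (0 : ℝ) < m := by linarith
      have hm1' : (1 : ℝ) ≤ m := by exact_mod_cast (show (1 : ℤ) ≤ m by exact_mod_cast hm0)
      linarith [ht.2]
    · obtain ⟨m, hm1, hm2⟩ := (memTU t).1 htU
      have hkm0 : (0 : ℝ) < m - k := by rw [hd] at ht; linarith [ht.1]
      have hkm1 : (1 : ℝ) ≤ m - k := by
        exact_mod_cast (show (1 : ℤ) ≤ m - k by exact_mod_cast hkm0)
      rw [hc] at htc
      linarith [ht.2]
  -- the two pieces
  refine ⟨(fun t ↦ K (circlePt t)) '' Icc bb c, (fun t ↦ K (circlePt t)) '' Icc d (a + 1),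
    (isCompact_Icc.image hgc).isClosed, (isCompact_Icc.image hgc).isClosed, ?_,
    (nonempty_Icc.2 hbc).image _, (nonempty_Icc.2 hda).image _, ?_⟩
  · -- disjoint: a common point would give two parameters differing by an integer in `(0, 1)`
    rw [Set.disjoint_left]
    rintro _ ⟨t, ht, rfl⟩ ⟨t', ht', he⟩
    obtain ⟨m, hm⟩ := (K.apply_circlePt_eq_iff).1 he
    have h0 : (0 : ℝ) < m := by linarith [ht.2, ht'.1]
    have h1 : (m : ℝ) < 1 := by linarith [ht.1, ht'.2]
    have h0' : (0 : ℤ) < m := by exact_mod_cast h0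
    have h1' : m < (1 : ℤ) := by exact_mod_cast h1
    omega
  · ext x
    constructor
    · rintro (⟨t, ht, rfl⟩ | ⟨t, ht, rfl⟩)
      · exact ⟨mem_range_self _, fun h ↦ h.elim (hgapL t ht).1 (hgapL t ht).2⟩
      · exact ⟨mem_range_self _, fun h ↦ h.elim (hgapR t ht).1 (hgapR t ht).2⟩
    · rintro ⟨⟨y, rfl⟩, hx⟩
      obtain ⟨t₀, rfl⟩ : ∃ t₀, circlePt t₀ = y := ⟨angA y, circlePt_angA y⟩
      -- normalise the parameter into `[bb, bb + 1)`
      set m : ℤ := ⌊t₀ - bb⌋ with hm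
      set t : ℝ := t₀ - m with ht
      have ht1 : bb ≤ t := by have := Int.floor_le (t₀ - bb); rw [ht]; linarith
      have ht2 : t < bb + 1 := by have := Int.lt_floor_add_one (t₀ - bb); rw [ht]; linarith
      have hKt : K (circlePt t) = K (circlePt t₀) := by
        rw [ht, sub_eq_add_neg, ← Int.cast_neg, hgper]
      have hxL : K (circlePt t) ∉ ℓ '' Ioo 0 1 := fun h ↦ hx (Or.inl (hKt ▸ h))
      have hxU : K (circlePt t) ∉ u '' Ioo 0 1 := fun h ↦ hx (Or.inr (hKt ▸ h))
      rcases le_or_gt t c with htc | htc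
      · exact Or.inl ⟨t, ⟨ht1, htc⟩, hKt⟩
      rcases lt_or_ge t d with htd | htd
      · -- `t - k` lies in the window of `u`
        exfalso
        apply hxU
        have hmem : t - k ∈ Ioo c₀ d₀ := ⟨by rw [hc] at htc; linarith, by rw [hd] at htd; linarith⟩
        exact (memTU t).2 ⟨k, hmem⟩
      rcases le_or_gt t (a + 1) with hta | hta
      · exact Or.inr ⟨t, ⟨htd, hta⟩, hKt⟩
      · -- `t - 1` lies in the window of `ℓ`
        exfalso
        apply hxL
        exact (memTL t).2 ⟨1, by push_cast; constructor <;> linarith⟩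

/-- `exists_isClosed_union_eq_range_diff` with the lift of the second arc only known to be
strictly monotone (as it is for an injective arc, `Knot.strictMonoOn_or_strictAntiOn_lift`):
reverse the second arc if its lift is decreasing (its open image is unchanged). [folklore] -/
theorem exists_isClosed_union_eq_range_diff' {ℓ u : ℝ → sphere (0 : EuclideanSpace ℝ (Fin 4)) 1} {φ ψ : ℝ → ℝ}
    (hφ : ContinuousOn φ (Icc 0 1)) (hψ : ContinuousOn ψ (Icc 0 1))
    (hφℓ : ∀ s ∈ Icc (0 : ℝ) 1, K (circlePt (φ s)) = ℓ s)
    (hψu : ∀ s ∈ Icc (0 : ℝ) 1, K (circlePt (ψ s)) = u s)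
    (hφm : StrictMonoOn φ (Ioo 0 1)) (hψm : StrictMonoOn ψ (Ioo 0 1) ∨ StrictAntiOn ψ (Ioo 0 1))
    (hℓinj : InjOn ℓ (Ioo 0 1)) (hdisj : Disjoint (ℓ '' Ioo 0 1) (u '' Ioo 0 1)) :
    ∃ P Q : Set (sphere (0 : EuclideanSpace ℝ (Fin 4)) 1), IsClosed P ∧ IsClosed Q ∧ Disjoint P Q ∧ P.Nonempty ∧ Q.Nonempty ∧
      P ∪ Q = range K \ (ℓ '' Ioo 0 1 ∪ u '' Ioo 0 1) := by
  rcases hψm with hψm | hanti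
  · exact K.exists_isClosed_union_eq_range_diff hφ hψ hφℓ hψu hφm hψm hℓinj hdisj
  · have himage : (fun s : ℝ ↦ u (1 - s)) '' Ioo 0 1 = u '' Ioo 0 1 := by
      rw [← Set.image_image u (fun s : ℝ ↦ 1 - s), Set.image_const_sub_Ioo]
      norm_num
    have hmaps : MapsTo (fun s : ℝ ↦ 1 - s) (Icc 0 1) (Icc 0 1) := fun s hs ↦
      ⟨by linarith [hs.2], by linarith [hs.1]⟩
    rw [← himage]
    exact K.exists_isClosed_union_eq_range_diff (u := fun s ↦ u (1 - s)) (ψ := fun s ↦ ψ (1 - s))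
      hφ (hψ.comp (continuousOn_const.sub continuousOn_id) hmaps) hφℓ
      (fun s hs ↦ hψu (1 - s) (hmaps hs)) hφm
      (fun x hx y hy hxy ↦ hanti ⟨by linarith [hy.2], by linarith [hy.1]⟩
        ⟨by linarith [hx.2], by linarith [hx.1]⟩ (by linarith))
      hℓinj (by rwa [himage])

end Knot

/-! ## The two edge lines of the band -/

namespace BandData

variable {K₁ K₂ K : Knot} {avoid : Set (sphere (0 : EuclideanSpace ℝ (Fin 4)) 1)} (b : BandData K₁ K₂ K avoid)

/-- The closed edge line `x₀ = a` of the collar square, `s ↦ band (a, -δ + s (1 + 2δ))` on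
`[0, 1]`, is a continuous arc (`a = 0`: the left edge, on `K₁`; `a = 1`: the right edge, on `K₂`;
the left one is `BandData.leftEdge` of `BandSumJunction.lean`). [folklore] -/
theorem continuous_bandEdge (a : ℝ) :
    Continuous fun s : ℝ ↦ b.band (pt2 a (-b.δ + s * (1 + 2 * b.δ))) :=
  b.contMDiff.continuous.comp ((continuous_pt2_right a).comp (by fun_prop))

/-- The height `-δ + s (1 + 2δ)` lies in `(-δ, 1 + δ)` for `s ∈ (0, 1)`. [folklore] -/
theorem edge_height_mem_Ioo {s : ℝ} (hs : s ∈ Ioo (0 : ℝ) 1) :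
    -b.δ + s * (1 + 2 * b.δ) ∈ Ioo (-b.δ) (1 + b.δ) := by
  have hδ := b.δ_pos
  constructor <;> nlinarith [hs.1, hs.2]

/-- The closed left edge lies on `K₁`. [folklore] -/
theorem bandEdge_zero_mem {s : ℝ} (hs : s ∈ Icc (0 : ℝ) 1) :
    b.band (pt2 0 (-b.δ + s * (1 + 2 * b.δ))) ∈ range K₁ := by
  have hδ := b.δ_pos
  exact b.band_pt2_zero_mem ⟨by nlinarith [hs.1, hs.2], by nlinarith [hs.1, hs.2]⟩

/-- The closed right edge lies on `K₂`. [folklore] -/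
theorem bandEdge_one_mem {s : ℝ} (hs : s ∈ Icc (0 : ℝ) 1) :
    b.band (pt2 1 (-b.δ + s * (1 + 2 * b.δ))) ∈ range K₂ := by
  have hδ := b.δ_pos
  exact b.band_pt2_one_mem ⟨by nlinarith [hs.1, hs.2], by nlinarith [hs.1, hs.2]⟩

/-- A point `(a, y)` with both coordinates in `(-δ, 1 + δ)` lies in the collar square. [folklore] -/
theorem pt2_mem_squareNhd {a y : ℝ} (ha : a ∈ Ioo (-b.δ) (1 + b.δ)) (hy : y ∈ Ioo (-b.δ) (1 + b.δ)) :
    pt2 a y ∈ squareNhd b.δ := by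
  intro i
  fin_cases i
  · simpa [pt2] using ha
  · simpa [pt2] using hy

/-- The open edge arcs (for `-δ < a < 1 + δ`) are injective (the band is injective on the collar
square and the height is an injective function of the parameter). [folklore] -/
theorem injOn_bandEdge {a : ℝ} (ha : a ∈ Ioo (-b.δ) (1 + b.δ)) :
    InjOn (fun s : ℝ ↦ b.band (pt2 a (-b.δ + s * (1 + 2 * b.δ)))) (Ioo 0 1) := by
  intro s hs s' hs' h
  have hδ := b.δ_pos
  have h1 := b.injOn (b.pt2_mem_squareNhd ha (b.edge_height_mem_Ioo hs))
    (b.pt2_mem_squareNhd ha (b.edge_height_mem_Ioo hs')) h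
  have h2 : -b.δ + s * (1 + 2 * b.δ) = -b.δ + s' * (1 + 2 * b.δ) := congrArg (fun x : EuclideanSpace ℝ (Fin 2) ↦ x 1) h1
  nlinarith [h2]

/-- **The part of `K₁` in the band surface is the open left edge**
`{band (0, y) | -δ < y < 1 + δ}` (`preimage_left`), parametrised over `(0, 1)`. [folklore] -/
theorem range_left_inter_support_eq_image : range K₁ ∩ b.support =
    (fun s : ℝ ↦ b.band (pt2 0 (-b.δ + s * (1 + 2 * b.δ)))) '' Ioo 0 1 := by
  have hδ := b.δ_pos
  ext x
  constructor
  · rintro ⟨hx, y, hy, rfl⟩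
    have hmem : y ∈ b.band ⁻¹' range K₁ ∩ squareNhd b.δ := ⟨hx, hy⟩
    rw [b.preimage_left] at hmem
    set s := (y 1 + b.δ) / (1 + 2 * b.δ) with hs
    have hy1 := hmem.1 1
    refine ⟨s, ⟨?_, ?_⟩, ?_⟩
    · rw [hs]; exact div_pos (by linarith [hy1.1]) (by linarith)
    · rw [hs, div_lt_one (by linarith)]; linarith [hy1.2]
    · show b.band (pt2 0 (-b.δ + s * (1 + 2 * b.δ))) = b.band y
      congr 1
      ext i
      fin_cases i
      · simpa [pt2] using hmem.2.symm
      · show -b.δ + s * (1 + 2 * b.δ) = y 1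
        rw [hs]; field_simp; ring
  · rintro ⟨s, hs, rfl⟩
    exact ⟨b.bandEdge_zero_mem (Ioo_subset_Icc_self hs), _,
      b.pt2_mem_squareNhd ⟨by linarith, by linarith⟩ (b.edge_height_mem_Ioo hs), rfl⟩

/-- **The part of `K₂` in the band surface is the open right edge**
`{band (1, y) | -δ < y < 1 + δ}` (`preimage_right`), parametrised over `(0, 1)`. [folklore] -/
theorem range_right_inter_support_eq_image : range K₂ ∩ b.support =
    (fun s : ℝ ↦ b.band (pt2 1 (-b.δ + s * (1 + 2 * b.δ)))) '' Ioo 0 1 := by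
  have hδ := b.δ_pos
  ext x
  constructor
  · rintro ⟨hx, y, hy, rfl⟩
    have hmem : y ∈ b.band ⁻¹' range K₂ ∩ squareNhd b.δ := ⟨hx, hy⟩
    rw [b.preimage_right] at hmem
    set s := (y 1 + b.δ) / (1 + 2 * b.δ) with hs
    have hy1 := hmem.1 1
    refine ⟨s, ⟨?_, ?_⟩, ?_⟩
    · rw [hs]; exact div_pos (by linarith [hy1.1]) (by linarith)
    · rw [hs, div_lt_one (by linarith)]; linarith [hy1.2]
    · show b.band (pt2 1 (-b.δ + s * (1 + 2 * b.δ))) = b.band y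
      congr 1
      ext i
      fin_cases i
      · simpa [pt2] using hmem.2.symm
      · show -b.δ + s * (1 + 2 * b.δ) = y 1
        rw [hs]; field_simp; ring
  · rintro ⟨s, hs, rfl⟩
    exact ⟨b.bandEdge_one_mem (Ioo_subset_Icc_self hs), _,
      b.pt2_mem_squareNhd ⟨by linarith, by linarith⟩ (b.edge_height_mem_Ioo hs), rfl⟩

/-- **The part of `K` in the band surface is the union of the two open arcs**
(`preimage_range`). [folklore] -/
theorem range_inter_support_eq_union : range K ∩ b.support =
    (fun s ↦ b.band (b.lowerArc s)) '' Ioo 0 1 ∪ (fun s ↦ b.band (b.upperArc s)) '' Ioo 0 1 := by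
  ext x
  constructor
  · rintro ⟨hx, y, hy, rfl⟩
    have hmem : y ∈ b.band ⁻¹' range K ∩ squareNhd b.δ := ⟨hx, hy⟩
    rw [b.preimage_range] at hmem
    rcases hmem with ⟨s, hs, hsy⟩ | ⟨s, hs, hsy⟩
    · exact Or.inl ⟨s, hs, by simp [hsy]⟩
    · exact Or.inr ⟨s, hs, by simp [hsy]⟩
  · rintro (⟨s, hs, rfl⟩ | ⟨s, hs, rfl⟩)
    · exact ⟨b.band_lowerArc_mem (Ioo_subset_Icc_self hs), _, (b.lowerArc_mem s hs).1, rfl⟩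
    · exact ⟨b.band_upperArc_mem (Ioo_subset_Icc_self hs), _, (b.upperArc_mem s hs).1, rfl⟩

/-- **`K₁` off the band surface is connected** (it is the complement in `K₁` of the open left
edge, `Knot.isConnected_range_diff_image_Ioo`). [folklore] -/
theorem isConnected_range_left_diff_support : IsConnected (range K₁ \ b.support) := by
  have hδ := b.δ_pos
  rw [← Set.sdiff_self_inter, b.range_left_inter_support_eq_image]
  exact K₁.isConnected_range_diff_image_Ioo (b.continuous_bandEdge 0)
    (fun s hs ↦ b.bandEdge_zero_mem hs) (b.injOn_bandEdge ⟨by linarith, by linarith⟩)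

/-- **`K₂` off the band surface is connected.** [folklore] -/
theorem isConnected_range_right_diff_support : IsConnected (range K₂ \ b.support) := by
  have hδ := b.δ_pos
  rw [← Set.sdiff_self_inter, b.range_right_inter_support_eq_image]
  exact K₂.isConnected_range_diff_image_Ioo (b.continuous_bandEdge 1)
    (fun s hs ↦ b.bandEdge_one_mem hs) (b.injOn_bandEdge ⟨by linarith, by linarith⟩)

/-- **Outside the band surface the summands are disjoint**: `K₁ ∖ S` and `K₂ ∖ S` are connected,
their union `K ∖ S` (`range_diff`) splits into the two nonempty closed gaps between the open
arcs of `K` (`Knot.exists_isClosed_union_eq_range_diff'`), and two connected sets filling two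
separated nonempty pieces are disjoint (`disjoint_of_isPreconnected_of_union_eq`). [folklore] -/
theorem disjoint_range_diff_support :
    Disjoint (range K₁ \ b.support) (range K₂ \ b.support) := by
  have hℓs := b.contMDiff_band_comp b.contDiff_lowerArc
  have hus := b.contMDiff_band_comp b.contDiff_upperArc
  obtain ⟨φ, hφ, hφℓ⟩ := K.exists_lift hℓs.continuous fun s hs ↦ b.band_lowerArc_mem hs
  obtain ⟨ψ, hψ, hψu⟩ := K.exists_lift hus.continuous fun s hs ↦ b.band_upperArc_mem hs
  have hφm := b.strictMonoOn_lift_lowerArc hφ hφℓ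
  have hψm := K.strictMonoOn_or_strictAntiOn_lift zero_lt_one hψ.continuousOn
    (fun s hs ↦ hψu s (Ioo_subset_Icc_self hs)) b.injOn_band_upperArc
  obtain ⟨P, Q, hP, hQ, hPQ, hPne, hQne, hPQu⟩ :=
    K.exists_isClosed_union_eq_range_diff' hφ.continuousOn hψ.continuousOn hφℓ hψu hφm hψm
      b.injOn_band_lowerArc b.disjoint_image_arcs
  refine disjoint_of_isPreconnected_of_union_eq b.isConnected_range_left_diff_support.isPreconnected
    b.isConnected_range_right_diff_support.isPreconnected hP hQ hPQ hPne hQne ?_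
  have hK : range K \ b.support = (range K₁ ∪ range K₂) \ b.support := b.range_diff
  rw [hPQu, ← Set.union_sdiff_distrib, ← hK, ← b.range_inter_support_eq_union, Set.sdiff_self_inter]

end BandData

/-! ## The discharge -/

namespace Knot

/-- **The summands of a band sum are disjoint** — discharge of the named fact
`Knot.IsBandSum.disjoint_range` (`BandSum.lean`): inside the band surface `K₁` and `K₂` are the
two (disjoint) edge lines (`BandData.disjoint_inter_support`), and outside it they are disjoint
by `BandData.disjoint_range_diff_support`. Gompf–Stipsicz (1999), §5.1; Cromwell (2004), §4.6.
[cite: GompfStipsicz1999, §5.1] -/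
theorem IsBandSum.disjoint_range_holds : IsBandSum.disjoint_range := by
  intro K₁ K₂ K avoid h
  obtain ⟨b⟩ := h
  rw [Set.disjoint_left]
  intro x hx₁ hx₂
  by_cases hxs : x ∈ b.support
  · exact Set.disjoint_left.1 b.disjoint_inter_support ⟨hx₁, hxs⟩ ⟨hx₂, hxs⟩
  · exact Set.disjoint_left.1 b.disjoint_range_diff_support ⟨hx₁, hxs⟩ ⟨hx₂, hxs⟩

/-- Disjointness of the summands for given band data (the form used as the hypothesis `hdisj`
of `BandData.orient_upper`, `BandData.exists_halfTurn` and the junction analysis). [folklore] -/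
theorem _root_.Literature.Topology.FourManifolds.BandData.disjoint_range {K₁ K₂ K : Knot}
    {avoid : Set (sphere (0 : EuclideanSpace ℝ (Fin 4)) 1)} (b : BandData K₁ K₂ K avoid) : Disjoint (range K₁) (range K₂) :=
  IsBandSum.disjoint_range_holds ⟨b⟩

end Knot

/-! ## Unconditional forms of the coherence statements of `BandSumCommProofs.lean` -/

namespace BandData

variable {K₁ K₂ K : Knot} {avoid : Set (sphere (0 : EuclideanSpace ℝ (Fin 4)) 1)}
  (b : BandData K₁ K₂ K avoid)

/-- **The upper arc of a band sum is traversed from right to left** — `BandData.orient_upper`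
with its disjointness hypothesis discharged by `BandData.disjoint_range`. [folklore] -/
theorem orient_upper' :
    ∃ θ c : ℝ, 0 < c ∧ K (circlePoint θ) = b.band (b.upperArc 2⁻¹) ∧
      deriv (fun t ↦ (K (circlePoint t) : EuclideanSpace ℝ (Fin 4))) θ =
        c • fderiv ℝ (fun x ↦ (b.band x : EuclideanSpace ℝ (Fin 4))) (b.upperArc 2⁻¹)
          (deriv b.upperArc 2⁻¹) :=
  b.orient_upper b.disjoint_range

/-- **Half-turn of band-sum data** — `BandData.exists_halfTurn` with its disjointness hypothesis
discharged by `BandData.disjoint_range`: `K` is a band sum of `K₂`, `K₁` along the band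
precomposed with `x ↦ (1, 1) - x`, with the same collar width. [folklore] -/
theorem exists_halfTurn' :
    ∃ b' : BandData K₂ K₁ K avoid, b'.δ = b.δ ∧ b'.band = fun x ↦ b.band (pt2 1 1 - x) :=
  b.exists_halfTurn b.disjoint_range

end BandData

end Literature.Topology.FourManifolds
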